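import Summits.QuantumFields.YangMills.Theorems.SqueezedSkewnessHBBumps
import Summits.QuantumFields.YangMills.Theorems.SqueezedSkewnessLowPassDFT
import HarnessLib

/-!
# Reading the route's lattice weights `ind` / `kap` off their interpolating bumps on the hypercube `(2L+1)⁴`
# (route-independent support for `SqueezedSkewness.TorusFloorsGlue`, stmt-QuantumFields-23206; LINE α of planner ym-idea-6 g10)

On the `Fin`-torus `(2L+1)⁴` a site `x` is read in centred coordinates `cc` (`cc i = i` for `2i < 2L+1`, `i − (2L+1)` otherwise);
a Schwartz bump `φ` of radius `s/4` at `s·(t, 0⃗)` reads the indicator weight `ind t` (`read_ind_bump`, `2t < 2L+1`), and the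
combination `Σ_z κ(z)·B_z` of bumps at `s·(t, cc z)` reads the slice weight `x ↦ 1[x₀ = t]·κ(x⃗)` (`read_kap_bumps`); the
Källén–Lehmann amplitude of that combination at a reciprocal-lattice momentum `2πq/(s(2L+1))` is `μ^{t−1}·χ(q mod 2L+1)` when
`κ = (2L+1)⁻³ Σ_{q'} χ(q') cos(2π q'·z/(2L+1))` is the cosine transform of a symmetric weight `χ` (`amp_kap_bumps`, discrete Fourier
inversion `lowPass_dft`).  These are the hypercube versions (fixed period, no thermal limit) of the identifications inside the LINE-2
glue `HighBallFloorsLPGlue`.  Pure bookkeeping; no definitions; no summit / NT / crux statement is touched. [folklore]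
-/

set_option autoImplicit false

noncomputable section

open scoped BigOperators
open Filter Topology Set Metric Finset Complex
open Literature.MathematicalPhysics.QuantumLattice
open Summit.QuantumFields.YangMills.Theorems.SqueezedSkewnessLowPassDFT
open Summit.QuantumFields.YangMills.Theorems.SqueezedSkewnessLatticeBumps
open Summit.QuantumFields.YangMills.Theorems.SqueezedSkewnessHBAmps
open Summit.QuantumFields.YangMills.Theorems.SqueezedSkewnessHBBumps

namespace Summit.QuantumFields.YangMills.Theorems.SqueezedSkewnessTorusFloorsBumps

/-- **A bump at `s·(t, 0⃗)` reads the indicator weight** `1[x = (t, 0⃗)]` at the centred coordinates of the sites of the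
hypercube `(2L+1)⁴` (`2t < 2L+1`). [folklore] -/
theorem read_ind_bump {s : ℝ} (L t : ℕ) (ht : 2 * t < 2 * L + 1) (φ : EuclideanSpace ℝ (Fin 4) → ℝ)
    (hφv : ∀ v : Fin 4 → ℤ, φ (s • siteToE (d := 4) v) = if (![(t : ℤ), 0, 0, 0] : Fin 4 → ℤ) = v then 1 else 0)
    (x : Fin (2 * L + 1) × Fin (2 * L + 1) × Fin (2 * L + 1) × Fin (2 * L + 1)) :
    φ (s • siteToE (d := 4) ![(if 2 * x.2.2.2.val < 2 * L + 1 then (x.2.2.2.val : ℤ) else (x.2.2.2.val : ℤ) - (2 * L + 1 : ℕ)),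
        (if 2 * x.1.val < 2 * L + 1 then (x.1.val : ℤ) else (x.1.val : ℤ) - (2 * L + 1 : ℕ)),
        (if 2 * x.2.1.val < 2 * L + 1 then (x.2.1.val : ℤ) else (x.2.1.val : ℤ) - (2 * L + 1 : ℕ)),
        (if 2 * x.2.2.1.val < 2 * L + 1 then (x.2.2.1.val : ℤ) else (x.2.2.1.val : ℤ) - (2 * L + 1 : ℕ))]) =
      if x.2.2.2.val = t ∧ x.1.val = 0 ∧ x.2.1.val = 0 ∧ x.2.2.1.val = 0 then 1 else 0 := by
  have h4 := cc_eq_iff (2 * L + 1) x.2.2.2 t ht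
  have h1 := cc_eq_iff (2 * L + 1) x.1 0 (by omega)
  have h2 := cc_eq_iff (2 * L + 1) x.2.1 0 (by omega)
  have h3 := cc_eq_iff (2 * L + 1) x.2.2.1 0 (by omega)
  simp only [Nat.cast_zero] at h1 h2 h3
  rw [hφv]
  refine if_congr ?_ rfl rfl
  rw [vec4_eq_iff]
  constructor
  · rintro ⟨a0, a1, a2, a3⟩
    exact ⟨h4.mp a0.symm, h1.mp a1.symm, h2.mp a2.symm, h3.mp a3.symm⟩
  · rintro ⟨b0, b1, b2, b3⟩
    exact ⟨(h4.mpr b0).symm, (h1.mpr b1).symm, (h2.mpr b2).symm, (h3.mpr b3).symm⟩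

/-- **The combination `Σ_z κ(z)·B_z` of bumps at `s·(t, cc z)` reads the slice weight** `x ↦ 1[x₀ = t]·κ(x⃗)` at the centred
coordinates of the sites of the hypercube `(2L+1)⁴` (`2t < 2L+1`). [folklore] -/
theorem read_kap_bumps {s : ℝ} (L t : ℕ) (ht : 2 * t < 2 * L + 1)
    (Bz : Fin (2 * L + 1) × Fin (2 * L + 1) × Fin (2 * L + 1) → EuclideanSpace ℝ (Fin 4) → ℝ)
    (hBv : ∀ (z : Fin (2 * L + 1) × Fin (2 * L + 1) × Fin (2 * L + 1)) (v : Fin 4 → ℤ), Bz z (s • siteToE (d := 4) v) =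
      if (![(t : ℤ),
        (if 2 * z.1.val < 2 * L + 1 then (z.1.val : ℤ) else (z.1.val : ℤ) - (2 * L + 1 : ℕ)),
        (if 2 * z.2.1.val < 2 * L + 1 then (z.2.1.val : ℤ) else (z.2.1.val : ℤ) - (2 * L + 1 : ℕ)),
        (if 2 * z.2.2.val < 2 * L + 1 then (z.2.2.val : ℤ) else (z.2.2.val : ℤ) - (2 * L + 1 : ℕ))] : Fin 4 → ℤ) = v
      then 1 else 0)
    (κ : Fin (2 * L + 1) × Fin (2 * L + 1) × Fin (2 * L + 1) → ℝ)
    (x : Fin (2 * L + 1) × Fin (2 * L + 1) × Fin (2 * L + 1) × Fin (2 * L + 1)) :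
    (∑ z, κ z * Bz z (s • siteToE (d := 4)
      ![(if 2 * x.2.2.2.val < 2 * L + 1 then (x.2.2.2.val : ℤ) else (x.2.2.2.val : ℤ) - (2 * L + 1 : ℕ)),
        (if 2 * x.1.val < 2 * L + 1 then (x.1.val : ℤ) else (x.1.val : ℤ) - (2 * L + 1 : ℕ)),
        (if 2 * x.2.1.val < 2 * L + 1 then (x.2.1.val : ℤ) else (x.2.1.val : ℤ) - (2 * L + 1 : ℕ)),
        (if 2 * x.2.2.1.val < 2 * L + 1 then (x.2.2.1.val : ℤ) else (x.2.2.1.val : ℤ) - (2 * L + 1 : ℕ))])) =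
      if x.2.2.2.val = t then κ (x.1, x.2.1, x.2.2.1) else 0 := by
  have h4 := cc_eq_iff (2 * L + 1) x.2.2.2 t ht
  simp only [hBv]
  have hz : ∀ z : Fin (2 * L + 1) × Fin (2 * L + 1) × Fin (2 * L + 1),
      ((![(t : ℤ),
          (if 2 * z.1.val < 2 * L + 1 then (z.1.val : ℤ) else (z.1.val : ℤ) - (2 * L + 1 : ℕ)),
          (if 2 * z.2.1.val < 2 * L + 1 then (z.2.1.val : ℤ) else (z.2.1.val : ℤ) - (2 * L + 1 : ℕ)),
          (if 2 * z.2.2.val < 2 * L + 1 then (z.2.2.val : ℤ) else (z.2.2.val : ℤ) - (2 * L + 1 : ℕ))]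
          : Fin 4 → ℤ) =
        ![(if 2 * x.2.2.2.val < 2 * L + 1 then (x.2.2.2.val : ℤ) else (x.2.2.2.val : ℤ) - (2 * L + 1 : ℕ)),
          (if 2 * x.1.val < 2 * L + 1 then (x.1.val : ℤ) else (x.1.val : ℤ) - (2 * L + 1 : ℕ)),
          (if 2 * x.2.1.val < 2 * L + 1 then (x.2.1.val : ℤ) else (x.2.1.val : ℤ) - (2 * L + 1 : ℕ)),
          (if 2 * x.2.2.1.val < 2 * L + 1 then (x.2.2.1.val : ℤ) else (x.2.2.1.val : ℤ) - (2 * L + 1 : ℕ))])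
      ↔ (x.2.2.2.val = t ∧ z = (x.1, x.2.1, x.2.2.1)) := by
    intro z
    rw [vec4_eq_iff]
    constructor
    · rintro ⟨a0, a1, a2, a3⟩
      refine ⟨h4.mp a0.symm, ?_⟩
      have e1 := cc_injective (2 * L + 1) a1
      have e2 := cc_injective (2 * L + 1) a2
      have e3 := cc_injective (2 * L + 1) a3
      exact Prod.ext e1 (Prod.ext e2 e3)
    · rintro ⟨b0, rfl⟩
      exact ⟨(h4.mpr b0).symm, rfl, rfl, rfl⟩
  simp only [hz]
  by_cases hx4 : x.2.2.2.val = t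
  · simp only [hx4, true_and, mul_ite, mul_one, mul_zero, Finset.sum_ite_eq', Finset.mem_univ, if_true]
  · simp [hx4]

/-- **Källén–Lehmann amplitude of the `kap` interpolant** `ψ = Σ_z κ(z)·B_z` (bumps at `s·(m+1, cc z)`) at the reciprocal-lattice
momentum `2πq/(s(2L+1))`: `μ^m · χ(q mod 2L+1)`, when `κ = (2L+1)⁻³ Σ_{q'} χ(q') cos(2π q'·z/(2L+1))` is the cosine transform of a
weight `χ` symmetric under `q' ↦ −q'`. [folklore] -/
theorem amp_kap_bumps (L m : ℕ) (hS : 0 < 2 * L + 1) {s : ℝ} (hs : 0 < s) (μ : ℝ) (q : Fin 3 → ℤ)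
    (χ : Fin (2 * L + 1) × Fin (2 * L + 1) × Fin (2 * L + 1) → ℝ)
    (hsymm : ∀ q₁ q₂ : Fin (2 * L + 1) × Fin (2 * L + 1) × Fin (2 * L + 1),
      (2 * L + 1) ∣ q₁.1.val + q₂.1.val → (2 * L + 1) ∣ q₁.2.1.val + q₂.2.1.val →
      (2 * L + 1) ∣ q₁.2.2.val + q₂.2.2.val → χ q₁ = χ q₂)
    (κχ : Fin (2 * L + 1) × Fin (2 * L + 1) × Fin (2 * L + 1) → ℝ)
    (hκχ : ∀ z, κχ z = (1 / ((2 * L + 1 : ℕ) : ℝ) ^ 3) * ∑ q' : Fin (2 * L + 1) × Fin (2 * L + 1) × Fin (2 * L + 1),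
        χ q' * Real.cos (2 * Real.pi *
          ((q'.1.val * z.1.val + q'.2.1.val * z.2.1.val + q'.2.2.val * z.2.2.val : ℕ) : ℝ) / ((2 * L + 1 : ℕ) : ℝ)))
    (Bz : Fin (2 * L + 1) × Fin (2 * L + 1) × Fin (2 * L + 1) → SchwartzMap (EuclideanSpace ℝ (Fin 4)) ℝ)
    (hBc : ∀ z, HasCompactSupport (Bz z : EuclideanSpace ℝ (Fin 4) → ℝ))
    (hBa : ∀ (z : Fin (2 * L + 1) × Fin (2 * L + 1) × Fin (2 * L + 1)) (μ' : ℝ) (p : Fin 3 → ℝ),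
      ∑' v : Fin 4 → ℤ, (((Bz z (s • siteToE (d := 4) v) * μ' ^ (Int.toNat (v 0 - 1))) : ℝ) : ℂ)
          * cexp (I * ((s * ∑ k : Fin 3, p k * (v k.succ : ℝ) : ℝ) : ℂ))
        = ((μ' ^ (Int.toNat ((![((m + 1 : ℕ) : ℤ),
            (if 2 * z.1.val < 2 * L + 1 then (z.1.val : ℤ) else (z.1.val : ℤ) - (2 * L + 1 : ℕ)),
            (if 2 * z.2.1.val < 2 * L + 1 then (z.2.1.val : ℤ) else (z.2.1.val : ℤ) - (2 * L + 1 : ℕ)),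
            (if 2 * z.2.2.val < 2 * L + 1 then (z.2.2.val : ℤ) else (z.2.2.val : ℤ) - (2 * L + 1 : ℕ))] : Fin 4 → ℤ) 0 - 1))
            : ℝ) : ℂ) *
          cexp (I * ((s * ∑ k : Fin 3, p k * ((![((m + 1 : ℕ) : ℤ),
            (if 2 * z.1.val < 2 * L + 1 then (z.1.val : ℤ) else (z.1.val : ℤ) - (2 * L + 1 : ℕ)),
            (if 2 * z.2.1.val < 2 * L + 1 then (z.2.1.val : ℤ) else (z.2.1.val : ℤ) - (2 * L + 1 : ℕ)),
            (if 2 * z.2.2.val < 2 * L + 1 then (z.2.2.val : ℤ) else (z.2.2.val : ℤ) - (2 * L + 1 : ℕ))] : Fin 4 → ℤ)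
              k.succ : ℝ) : ℝ) : ℂ))) :
    ∑' x : Fin 4 → ℤ, ((((∑ z, κχ z • Bz z) (s • siteToE (d := 4) x) * μ ^ (Int.toNat (x 0 - 1))) : ℝ) : ℂ) *
        cexp (I * ((s * ∑ k : Fin 3, (2 * Real.pi * (q k : ℝ) / (s * (2 * L + 1))) * (x k.succ : ℝ) : ℝ) : ℂ))
      = ((μ ^ m * χ (⟨((q 0) % ((2 * L + 1 : ℕ) : ℤ)).toNat, toNat_emod_lt (2 * L + 1) hS (q 0)⟩,
          ⟨((q 1) % ((2 * L + 1 : ℕ) : ℤ)).toNat, toNat_emod_lt (2 * L + 1) hS (q 1)⟩,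
          ⟨((q 2) % ((2 * L + 1 : ℕ) : ℤ)).toNat, toNat_emod_lt (2 * L + 1) hS (q 2)⟩) : ℝ) : ℂ) := by
  have hSR : ((2 * L + 1 : ℕ) : ℝ) = 2 * (L : ℝ) + 1 := by push_cast; ring
  have hm1 : Int.toNat (((m + 1 : ℕ) : ℤ) - 1) = m := by simp
  have hAB : ∀ z, ∑' x : Fin 4 → ℤ,
      ((((Bz z (s • siteToE (d := 4) x) * μ ^ (Int.toNat (x 0 - 1))) : ℝ) : ℂ) *
        cexp (I * ((s * ∑ k : Fin 3, (2 * Real.pi * (q k : ℝ) / (s * (2 * L + 1))) * (x k.succ : ℝ) : ℝ) : ℂ)))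
      = ((μ ^ m : ℝ) : ℂ) *
        cexp (2 * Real.pi * I * ((q 0 : ℂ) * ((z.1 : ℕ) : ℂ) + (q 1 : ℂ) * ((z.2.1 : ℕ) : ℂ) +
          (q 2 : ℂ) * ((z.2.2 : ℕ) : ℂ)) / ((2 * L + 1 : ℕ) : ℂ)) := by
    intro z
    rw [hBa]
    have hph := phase_cc hs.ne' (2 * L + 1) hS q ((m + 1 : ℕ) : ℤ) z
    rw [hSR] at hph
    rw [hph]
    simp only [Matrix.cons_val_zero, hm1]
  rw [latticeSum_sum_smul κχ Bz hs hBc]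
  simp only [hAB]
  have hfac : ∑ z : Fin (2 * L + 1) × Fin (2 * L + 1) × Fin (2 * L + 1), (κχ z : ℂ) * (((μ ^ m : ℝ) : ℂ) *
        cexp (2 * Real.pi * I * ((q 0 : ℂ) * ((z.1 : ℕ) : ℂ) + (q 1 : ℂ) * ((z.2.1 : ℕ) : ℂ) +
          (q 2 : ℂ) * ((z.2.2 : ℕ) : ℂ)) / ((2 * L + 1 : ℕ) : ℂ)))
      = ((μ ^ m : ℝ) : ℂ) * ∑ z : Fin (2 * L + 1) × Fin (2 * L + 1) × Fin (2 * L + 1), (κχ z : ℂ) *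
        cexp (2 * Real.pi * I * ((q 0 : ℂ) * ((z.1 : ℕ) : ℂ) + (q 1 : ℂ) * ((z.2.1 : ℕ) : ℂ) +
          (q 2 : ℂ) * ((z.2.2 : ℕ) : ℂ)) / ((2 * L + 1 : ℕ) : ℂ)) := by
    rw [Finset.mul_sum]
    refine Finset.sum_congr rfl fun z _ => ?_
    ring
  rw [hfac]
  simp only [hκχ]
  rw [lowPass_dft (2 * L + 1) hS χ hsymm (q 0) (q 1) (q 2)]
  push_cast
  ring

end Summit.QuantumFields.YangMills.Theorems.SqueezedSkewnessTorusFloorsBumps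

end
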